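import Summits.MatrixMultiplication.MatrixMultiplication.Theorems.AbelianSTPPCensusShapeCertVQDefsP

/-!
# Abelian STPP census — kernel evaluation of the budgeted vQ certificate at order 414, path segments (part b)

Cell mm-stpp, rung F-M1; successor kernel item VQ-CERT (T_E beyond 337 under vQ := vP ∧ E3⁺) in support of the closed crux item
stmt-MatrixMultiplication-19191; seat mm-stpp-vp-p2 (gen 1); support file (no definitions).  PATH SEGMENTS `ShapeCertVQ.pathSegQE M path i n`
(`…ShapeCertVQDefsP`) of `ShapeCertVQ.checkQE 414`: the node-level decision of the budgeted search at the node reached by the candidate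
indices `path` (last step first; `[]` = root) and the walk of its pool's candidates `i … i+n−1`, each by `decide +kernel` (no
`native_decide`, standard axioms, `Elab.async false`), sized from the seat's per-node cost profile (calc/pathplan_*.txt, cost = visits +
nodes ≤ 4.5·10³ where the tree allows).  Assembled into `checkQE 414 = true` in `…ShapeCertVQEvalP414` by the lemmas of `…ShapeCertVQSearchP`.
WHAT THIS IS NOT: Boolean evaluations; no statement about STPP families or `ω` by themselves.
-/

set_option linter.dupNamespace false -- `MatrixMultiplication.MatrixMultiplication` (summit = problem, D-0017)
set_option autoImplicit false
set_option Elab.async false -- sequential kernel evaluations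

namespace Summit.MatrixMultiplication.MatrixMultiplication.Theorems.ShapeCertVQ

set_option maxHeartbeats 0 in
/-- path segment of the budgeted vQ certificate at order `414`: node `[85]` (last step first), candidates `6 … 71` (cost ≈ 4499; kernel evaluation) -/
theorem ps_414_r_85_6 : pathSegQE 414 [85] 6 66 = true := by
  decide +kernel

set_option maxHeartbeats 0 in
/-- path segment of the budgeted vQ certificate at order `414`: node `[85]` (last step first), candidates `72 …` (cost ≈ 27; kernel evaluation) -/
theorem ps_414_r_85_72 : pathSegQE 414 [85] 72 9999 = true := by
  decide +kernel

set_option maxHeartbeats 0 in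
/-- path segment of the budgeted vQ certificate at order `414`: node `[]` (last step first), candidates `86 … 90` (cost ≈ 850; kernel evaluation) -/
theorem ps_414_r_86 : pathSegQE 414 [] 86 5 = true := by
  decide +kernel

set_option maxHeartbeats 0 in
/-- path segment of the budgeted vQ certificate at order `414`: node `[]` (last step first), candidates `91 … 91` (cost ≈ 4489; kernel evaluation) -/
theorem ps_414_r_91 : pathSegQE 414 [] 91 1 = true := by
  decide +kernel

set_option maxHeartbeats 0 in
/-- path segment of the budgeted vQ certificate at order `414`: node `[]` (last step first), candidates `92 … 109` (cost ≈ 4144; kernel evaluation) -/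
theorem ps_414_r_92 : pathSegQE 414 [] 92 18 = true := by
  decide +kernel

set_option maxHeartbeats 0 in
/-- path segment of the budgeted vQ certificate at order `414`: node `[]` (last step first), candidates `110 … 112` (cost ≈ 4374; kernel evaluation) -/
theorem ps_414_r_110 : pathSegQE 414 [] 110 3 = true := by
  decide +kernel

end Summit.MatrixMultiplication.MatrixMultiplication.Theorems.ShapeCertVQ
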